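import Summits.Ventures.PercRepro.ProfilePointedCircuitClassesStarSharpS

/-! # Rank-3 incidence facts «modulo `B`» for the D1 regime of `StarNineSharp` (p5 g53, §80 ADD 7(f), ADD 9(b))

The D1 core of `StarNineSharp` (`parallel_twin_e_core_iff`, ProfilePointedCircuitClassesStarSharpW) is the six-point
lemma on the contraction `M″ = (N ／ {e, b′}) ∖ x`, whose rank is `rk_{M″}(S) = rk N (S ∪ B) − 2` with `B = {e, b′}`.
Its proof (§80 ADD 7(f)) uses five incidence facts of a rank-3 matroid — «a line holds at most two points of a basis»,
«two sides of a triangle meet in a vertex», «a point off a line completes an independent pair of the line to a basis»,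
«two lines through an independent pair coincide».  Each is ONE submodularity step in `N` on sets containing `B`:
`rk (S ∪ T) + rk I ≤ rk S + rk T` for `I ⊆ S ∩ T` (`rk_union_add_rk_le_of_subset_inter`).  They are stated here for an
ARBITRARY `B ⊆ gr N` with `r := rk N B`, so that they serve any contraction. -/

open scoped Matroid

namespace PercRepro.Cogirth

open Finset ThmH Skew Shadow Profile

variable {α : Type} [DecidableEq α] {N : Matroid α} [N.Finite]

section StarSharpX

/-- Submodularity with a sub-intersection: `ρ(S ∪ T) + ρ(I) ≤ ρ(S) + ρ(T)` whenever `I ⊆ S ∩ T`. -/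
theorem rk_union_add_rk_le_of_subset_inter {S T I : Finset α} (hI : I ⊆ S ∩ T) :
    rk N (S ∪ T) + rk N I ≤ rk N S + rk N T := by
  have h1 := rk_inter_add_rk_union_le' (M := N) S T
  have h2 : rk N I ≤ rk N (S ∩ T) := rk_mono' (M := N) hI
  omega

/-- **A line holds at most two points of a basis** (modulo `B`): if `u, b` are independent modulo `B` and `v₁, v₂, v₃`
all lie on the line `ub`, then `{v₁, v₂, v₃}` has rank `≤ r + 2` modulo `B`. -/
theorem rk_triple_le_of_on_line {B : Finset α} {u b v₁ v₂ v₃ : α} (hub : rk N B + 2 ≤ rk N ({u, b} ∪ B))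
    (h1 : rk N ({u, b, v₁} ∪ B) ≤ rk N B + 2) (h2 : rk N ({u, b, v₂} ∪ B) ≤ rk N B + 2)
    (h3 : rk N ({u, b, v₃} ∪ B) ≤ rk N B + 2) :
    rk N ({v₁, v₂, v₃} ∪ B) ≤ rk N B + 2 := by
  have s12 := rk_union_add_rk_le_of_subset_inter (N := N) (S := {u, b, v₁} ∪ B) (T := {u, b, v₂} ∪ B)
    (I := {u, b} ∪ B) (by
      intro y hy
      simp only [mem_union, mem_inter, mem_insert, mem_singleton] at hy ⊢
      tauto)
  have s3 := rk_union_add_rk_le_of_subset_inter (N := N) (S := ({u, b, v₁} ∪ B) ∪ ({u, b, v₂} ∪ B))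
    (T := {u, b, v₃} ∪ B) (I := {u, b} ∪ B) (by
      intro y hy
      simp only [mem_union, mem_inter, mem_insert, mem_singleton] at hy ⊢
      tauto)
  have hm : rk N ({v₁, v₂, v₃} ∪ B) ≤ rk N (({u, b, v₁} ∪ B) ∪ ({u, b, v₂} ∪ B) ∪ ({u, b, v₃} ∪ B)) :=
    rk_mono' (M := N) (by
      intro y hy
      simp only [mem_union, mem_insert, mem_singleton] at hy ⊢
      tauto)
  omega

/-- **Two sides of a triangle meet in a vertex** (modulo `B`): if `b` lies on the sides `v₁v₂` and `v₁v₃` of a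
triangle `{v₁, v₂, v₃}` (rank `r + 3` modulo `B`), then `b` is parallel to `v₁` modulo `B`. -/
theorem rk_pair_le_of_on_two_sides {B : Finset α} {b v₁ v₂ v₃ : α}
    (h12 : rk N ({v₁, v₂, b} ∪ B) ≤ rk N B + 2) (h13 : rk N ({v₁, v₃, b} ∪ B) ≤ rk N B + 2)
    (h123 : rk N B + 3 ≤ rk N ({v₁, v₂, v₃} ∪ B)) :
    rk N ({v₁, b} ∪ B) ≤ rk N B + 1 := by
  have s := rk_union_add_rk_le_of_subset_inter (N := N) (S := {v₁, v₂, b} ∪ B) (T := {v₁, v₃, b} ∪ B)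
    (I := {v₁, b} ∪ B) (by
      intro y hy
      simp only [mem_union, mem_inter, mem_insert, mem_singleton] at hy ⊢
      tauto)
  have hm : rk N ({v₁, v₂, v₃} ∪ B) ≤ rk N (({v₁, v₂, b} ∪ B) ∪ ({v₁, v₃, b} ∪ B)) :=
    rk_mono' (M := N) (by
      intro y hy
      simp only [mem_union, mem_insert, mem_singleton] at hy ⊢
      tauto)
  omega

/-- **A point off a line completes an independent pair of the line to a basis** (modulo `B`): if `u, v, v′, b` lie on
one line, `{v, v′, s}` is a basis and `{u, v′}` is independent (all modulo `B`), then `{u, v′, s}` is a basis. -/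
theorem rk_triple_ge_of_off_line {B : Finset α} {u v v' s b : α}
    (hline : rk N ({u, v, v', b} ∪ B) ≤ rk N B + 2) (hbasis : rk N B + 3 ≤ rk N ({v, v', s} ∪ B))
    (huv' : rk N B + 2 ≤ rk N ({u, v'} ∪ B)) :
    rk N B + 3 ≤ rk N ({u, v', s} ∪ B) := by
  have s1 := rk_union_add_rk_le_of_subset_inter (N := N) (S := {u, v', s} ∪ B) (T := {u, v, v', b} ∪ B)
    (I := {u, v'} ∪ B) (by
      intro y hy
      simp only [mem_union, mem_inter, mem_insert, mem_singleton] at hy ⊢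
      tauto)
  have hm : rk N ({v, v', s} ∪ B) ≤ rk N (({u, v', s} ∪ B) ∪ ({u, v, v', b} ∪ B)) :=
    rk_mono' (M := N) (by
      intro y hy
      simp only [mem_union, mem_insert, mem_singleton] at hy ⊢
      tauto)
  omega

/-- **Two lines through an independent pair coincide** (modulo `B`): if `u` and `v` both lie on the line `ww′` of an
independent pair `{w, w′}`, then `{u, v, w, w′}` has rank `≤ r + 2` modulo `B`. -/
theorem rk_quad_le_of_on_line {B : Finset α} {u v w w' : α}
    (hu : rk N ({u, w, w'} ∪ B) ≤ rk N B + 2) (hv : rk N ({v, w, w'} ∪ B) ≤ rk N B + 2)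
    (hww : rk N B + 2 ≤ rk N ({w, w'} ∪ B)) :
    rk N ({u, v, w, w'} ∪ B) ≤ rk N B + 2 := by
  have s := rk_union_add_rk_le_of_subset_inter (N := N) (S := {u, w, w'} ∪ B) (T := {v, w, w'} ∪ B)
    (I := {w, w'} ∪ B) (by
      intro y hy
      simp only [mem_union, mem_inter, mem_insert, mem_singleton] at hy ⊢
      tauto)
  have hm : rk N ({u, v, w, w'} ∪ B) ≤ rk N (({u, w, w'} ∪ B) ∪ ({v, w, w'} ∪ B)) :=
    rk_mono' (M := N) (by
      intro y hy
      simp only [mem_union, mem_insert, mem_singleton] at hy ⊢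
      tauto)
  omega

end StarSharpX

end PercRepro.Cogirth
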